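import Mathlib
import Literature.Combinatorics.Enumerative.TwoAdicZetaFiveAperyLikeLucas
import HarnessLib

/-!
# Lai–Sprang–Zudilin 2026: the three-term recursion of the leading coefficients `ρ_n` (typed) and the
Gauss/Dwork consequences of their Lucas congruences (PROVED)

Topic `Literature/NumberTheory/Irrationality/LaiSprangZudilin2026`.  Source: L. Lai, J. Sprang, W. Zudilin,
*A note on the irrationality of `ζ₂(5)`*, Int. Math. Res. Not. IMRN **2026**:16, rnag180 = arXiv:2505.05005
[LaiSprangZudilin2026] (held text `paper:arxiv-2505.05005`, arXiv numbering; read on the page: §1 p. 3 of the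
text = the recursion (eq:rec), §5 pp. 8–9 = Lemma 5.2 and its proof).  The irrationality statement itself
(Theorem 1.1) is typed in `PAdicZetaValues/Records.lean` (`laiSprangZudilin2026_theorem11`); nothing here
concerns it.

DEDUP NOTE.  The sequence itself — the printed double sum of Lemma 5.2 — is the tree's
`Literature.Combinatorics.Enumerative.TwoAdicZetaFiveAperyLikeLucas.lszRho` (with `lszRho_zero/one/two` and the
Lucas congruences `lszRho_modEq_mul`, `lszRho_natModEq_mul`, `lszRho_modEq_prod_digits` at every prime, via
[AdamczewskiBellDelaygue2019, Props. 8.7, 7.4]); this file USES it and does not re-declare it (its first version,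
written in parallel, carried a duplicate `rho` with the same Lucas proof; removed here).

## Source, as printed

* §1, display (eq:rec): «our approximations satisfy a three-term Apéry-like recurrence relation
  `(n+1)⁵ρ_{n+1} − 32(2n+1)(8n⁴+16n³+20n²+12n+3)ρ_n + 2¹⁶n⁵ρ_{n−1} = 0` for `n = 1, 2, …`. … it admits a
  solution `{ρ_0, ρ_1, ρ_2, …} = {1, 96, 14944, …}` which is integer-valued — we give an explicit binomial
  expression for the latter.»
* **Lemma 5.2.** «The solution `(ρ_n)_{n≥0}` of the difference equation (eq:rec) with the initial conditions
  `ρ_0 = 1`, `ρ_1 = 96` is given by the binomial double sum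
  `ρ_n = Σ_{0≤i≤k≤n} 2^{4(n−k)} C(2i,i)² C(2n−2i,n−i) C(2k−2i,k−i) C(2k,k)² C(2n−2k,n−k)`.
  Furthermore, for the coefficients `ρ_{n,3}` given in (def_rho_3) we have `ρ_{n,3} = 768ρ_n ∈ ℤ` for
  `n ∈ ℤ_{≥0}`.» (Proof in print: «one can easily verify that the double sum indeed satisfies the recursion
  (eq:rec) with the help of multi-sum algorithms of creative telescoping», followed by a human proof via the
  `ε`-deformation of `R_n(t) = 2^{8n}(2t+n)(t+½)_n⁴/(t)_{n+1}⁴` and the Andrews/Krattenthaler–Rivoal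
  transformation of a terminating very-well-poised `₉V₈`.)

## What is formalised

* `recMid n` — the middle coefficient of (eq:rec); NAMED FACT `recurrence` (statement only): the double sum
  `lszRho` satisfies (eq:rec) for every `n ≥ 1` (written additively over `ℕ`) — the content of Lemma 5.2 given
  the initial values `lszRho_zero`, `lszRho_one` (a discharge formalises either a two-level creative-telescoping
  certificate or the printed `₉V₈` route; neither is in the tree).  Kernel checks of the transcription:
  `lszRho_three` and (eq:rec) at `n = 1, 2` (`recurrence_one`, `recurrence_two`).
* PROVED consequences of the tree's Lucas congruence `lszRho_natModEq_mul` (these three are not stated in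
  [LaiSprangZudilin2026], which does not discuss congruences for `ρ_n`; they are what a user of the Lucas
  property typically consumes): `lszRho_modEq_mod_mul_div` (`ρ_n ≡ ρ_{n mod p} ρ_{⌊n/p⌋}`),
  `lszRho_prime_mul_modEq` (`ρ_{pN} ≡ ρ_N (mod p)`, the first Gauss congruence), `lszRho_dwork_modEq`
  (`ρ_{n+mp} ρ_{⌊n/p⌋} ≡ ρ_n ρ_{⌊n/p⌋+m} (mod p)`, the first Dwork congruence), and the `ℕ`-form of the
  all-digits congruence `lszRho_natModEq_prod_digits` (`ρ_n ≡ ∏_i ρ_{n_i} (mod p)` in `Nat.ModEq`).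

Not covered: `ρ_{n,0}`, `ρ_{n,3}`, `R_n(t)`, Lemma 4.1's certificate, Lemma 5.3, the expectation (5.2)
(«den-con», open in print), any congruence modulo `p²` or `p³`.  Nearest existing declarations (used, not
restated): `TwoAdicZetaFiveAperyLikeLucas.{lszRho, lszRho_zero, lszRho_one, lszRho_two, lszRho_natModEq_mul,
lszRho_modEq_prod_digits}`; `PAdicZetaValues.Records.laiSprangZudilin2026_theorem11`.
-/

namespace Literature.NumberTheory.Irrationality.LaiSprangZudilin2026

open Finset Literature.Combinatorics.Enumerative.TwoAdicZetaFiveAperyLikeLucas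

/-! ## The three-term recursion (eq:rec) -/

/-- `ρ_3 = 2743296` (kernel evaluation of the printed double sum; used in `recurrence_two`).
[cite: LaiSprangZudilin2026, Lemma 5.2] -/
theorem lszRho_three : lszRho 3 = 2743296 := by decide

/-- The middle coefficient `32(2n+1)(8n⁴+16n³+20n²+12n+3)` of the recursion (eq:rec).
[cite: LaiSprangZudilin2026, §1 (eq:rec)] -/
def recMid (n : ℕ) : ℕ := 32 * (2 * n + 1) * (8 * n ^ 4 + 16 * n ^ 3 + 20 * n ^ 2 + 12 * n + 3)

/-- **Lemma 5.2 (the recursion half; named fact, statement only)**: the double sum `ρ_n` (`lszRho`) satisfies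
`(n+1)⁵ρ_{n+1} − 32(2n+1)(8n⁴+16n³+20n²+12n+3)ρ_n + 2¹⁶n⁵ρ_{n−1} = 0` for every `n ≥ 1` (written additively over
`ℕ`).  In print: the unique solution of (eq:rec) with `ρ_0 = 1`, `ρ_1 = 96` «is given by the binomial double
sum» (initial values: `lszRho_zero`, `lszRho_one`; the cases `n = 1, 2`: `recurrence_one`, `recurrence_two`).
[cite: LaiSprangZudilin2026, Lemma 5.2 and §1 (eq:rec)] -/
def recurrence : Prop :=
  ∀ n : ℕ, 1 ≤ n → (n + 1) ^ 5 * lszRho (n + 1) + 2 ^ 16 * n ^ 5 * lszRho (n - 1) = recMid n * lszRho n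

/-- (eq:rec) at `n = 1`: `2⁵ρ_2 + 2¹⁶ρ_0 = 32·3·59·ρ_1` (kernel check of the transcription).
[cite: LaiSprangZudilin2026, §1 (eq:rec)] -/
theorem recurrence_one :
    (1 + 1) ^ 5 * lszRho (1 + 1) + 2 ^ 16 * 1 ^ 5 * lszRho (1 - 1) = recMid 1 * lszRho 1 := by
  rw [lszRho_two, lszRho_one, Nat.sub_self, lszRho_zero]
  decide

/-- (eq:rec) at `n = 2`: `3⁵ρ_3 + 2¹⁶·2⁵ρ_1 = 32·5·355·ρ_2` (kernel check of the transcription).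
[cite: LaiSprangZudilin2026, §1 (eq:rec)] -/
theorem recurrence_two :
    (2 + 1) ^ 5 * lszRho (2 + 1) + 2 ^ 16 * 2 ^ 5 * lszRho (2 - 1) = recMid 2 * lszRho 2 := by
  rw [lszRho_three, lszRho_two, show 2 - 1 = 1 from rfl, lszRho_one]
  decide

/-! ## Consequences of the Lucas congruence -/

section Lucas

variable {p : ℕ} [hp : Fact p.Prime]

/-- `ρ_n ≡ ρ_{n mod p} ρ_{⌊n/p⌋} (mod p)`, every prime `p`.
[cite: AdamczewskiBellDelaygue2019, Def. 3.8, Prop. 7.4] [cite: LaiSprangZudilin2026, Lemma 5.2] -/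
theorem lszRho_modEq_mod_mul_div (n : ℕ) : lszRho n ≡ lszRho (n % p) * lszRho (n / p) [MOD p] := by
  have h := lszRho_natModEq_mul (p := p) (n % p) (n / p) (Nat.mod_lt n hp.out.pos)
  rwa [Nat.mod_add_div n p] at h

/-- **The first Gauss congruence** `ρ_{pN} ≡ ρ_N (mod p)` (the case `n₀ = 0`, `ρ_0 = 1`), every prime `p`.
[cite: AdamczewskiBellDelaygue2019, Def. 3.8, Prop. 7.4] [cite: LaiSprangZudilin2026, Lemma 5.2] -/
theorem lszRho_prime_mul_modEq (N : ℕ) : lszRho (p * N) ≡ lszRho N [MOD p] := by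
  have h := lszRho_natModEq_mul (p := p) 0 N hp.out.pos
  rwa [zero_add, lszRho_zero, one_mul] at h

/-- **The first Dwork congruence for `ρ_n`** (a formal consequence of the Lucas property):
`ρ_{n+mp} ρ_{⌊n/p⌋} ≡ ρ_n ρ_{⌊n/p⌋+m} (mod p)` for all `n, m` and every prime `p`.
[cite: AdamczewskiBellDelaygue2019, Def. 3.8, Prop. 7.4] [cite: LaiSprangZudilin2026, Lemma 5.2] -/
theorem lszRho_dwork_modEq (n m : ℕ) :
    lszRho (n + m * p) * lszRho (n / p) ≡ lszRho n * lszRho (n / p + m) [MOD p] := by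
  have hp0 : 0 < p := hp.out.pos
  have h1 : lszRho (n + m * p) ≡ lszRho (n % p) * lszRho (n / p + m) [MOD p] := by
    have h := lszRho_natModEq_mul (p := p) (n % p) (n / p + m) (Nat.mod_lt n hp0)
    have e : n % p + p * (n / p + m) = n + m * p := by
      have := Nat.mod_add_div n p
      rw [mul_add, ← add_assoc, this, mul_comm]
    rwa [e] at h
  have h2 := lszRho_modEq_mod_mul_div (p := p) n
  calc lszRho (n + m * p) * lszRho (n / p)
      ≡ lszRho (n % p) * lszRho (n / p + m) * lszRho (n / p) [MOD p] := h1.mul_right _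
    _ = lszRho (n % p) * lszRho (n / p) * lszRho (n / p + m) := by ring
    _ ≡ lszRho n * lszRho (n / p + m) [MOD p] := h2.symm.mul_right _

/-- The all-digits Lucas congruence in `ℕ`: `ρ_n ≡ ∏_i ρ_{n_i} (mod p)` over the base-`p` digits `n_i` of `n`
(`Nat.ModEq` form of the tree's `lszRho_modEq_prod_digits`).
[cite: AdamczewskiBellDelaygue2019, Def. 3.8, Prop. 7.4] [cite: LaiSprangZudilin2026, Lemma 5.2] -/
theorem lszRho_natModEq_prod_digits (n : ℕ) : lszRho n ≡ ((Nat.digits p n).map lszRho).prod [MOD p] := by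
  have h := lszRho_modEq_prod_digits (p := p) n
  refine (Int.natCast_modEq_iff).mp ?_
  have e' : (((Nat.digits p n).map lszRho).prod : ℤ) = ((Nat.digits p n).map fun k => (lszRho k : ℤ)).prod := by
    rw [Nat.cast_list_prod, List.map_map]
    rfl
  rw [e']
  exact h

end Lucas

end Literature.NumberTheory.Irrationality.LaiSprangZudilin2026
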